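import Summits.Parity.BatemanHorn.Theorems.SoloInformedThinRowsII
import Summits.Parity.BatemanHorn.Theorems.SoloInformedThinPolynomialSharp
import Summits.Parity.BatemanHorn.Theorems.SoloInformedThinSharpQ
import HarnessLib

/-!
# Thin sequences vs. Type-I/II information, XXI: the Type-II window against Ford–Maynard's family

Corollaries of `eventually_not_typeII_of_sparse_rows` (`SoloInformedThinRowsII`) for
Ford–Maynard's short-interval comparison sequences `(x/2y)·1_{x−y<n≤x}` and their `(n,q)=1`
twists (Lemma 4.6 of [cite: FordMaynard2024PrimeSieves, §4.2 (Lemma 4.6)]), whose rows `p ≤ y/2`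
(`p ≤ y/(2q)`, `p ∤ q`) have mass `≥ x/(4p)`:
* `eventually_not_typeII_shortInterval_top`: ¬(II) whenever `θ + ν > 1 − c` (`0 ≤ η < c`,
  `θ + η < 1`, `x^{1−η}/2 ≤ y ≤ x/2`); with `eventually_not_typeII_shortInterval_sharp` (`θ < c`,
  `SoloInformedThinSharp`) the WINDOW theorem `…_window` (¬(II) unless `c ≤ θ`, `θ + ν ≤ 1 − c`)
  and `…_half`: a support of size `≤ x^{1/2}` carries no Type-II information at all;
* `eventually_not_typeII_shortInterval_coprime_top`: the twisted sequences, `2x^κ q ≤ y ≤ x/2`,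
  `κ > max(θ, 1 − c)`, no height condition;
* polynomial growth `g k ≥ k^d`, `d ≥ 2` (support `≤ x^{1/d} + 1`): `…_polyGrowth_…_top` and the
  unconditional `eventually_not_typeII_polyGrowth_shortInterval_all` /
  `…_coprime_all` — for EVERY window `[θ, θ + ν]` (`θ ≥ 0`, `ν > 0`, `θ + η < 1`, resp. `θ < 1`,
  `θ < κ`), the values of `g` carry no Type-II information against these comparisons; `k² + 1`:
  `eventually_not_typeII_sq_add_one_shortInterval_all`, `…_coprime_all`.
All statements are one-sided (necessary conditions); no claim is made toward `BatemanHorn`.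
-/

noncomputable section

open Filter Finset Real

namespace Summit.Parity.BatemanHorn.Theorems

open Literature.Barriers.Parity.FordMaynard (TypeII eventually_mul_rpow_le_rpow)

/-- **Short intervals, Type II above the co-density.**  Let `0 ≤ θ`, `ν > 0`, `θ + ν > 1 − c`,
`0 ≤ η < c`, `θ + η < 1`, `B > 1`.  For all large `x`, every real `a` with at most `x^{1−c}`
non-zero values on `(x/2, x]` and every `x^{1−η}/2 ≤ y ≤ x/2`:  `w = a − (x/2y)·1_{x−y<n≤x}`
violates (II) in `[θ, θ + ν]`.  (The rows `p ≍ x^e`, `max(θ, 1−c) < e < min(θ+ν, 1−η)`, have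
mass `≥ x/(4p)`.) [cite: FordMaynard2024PrimeSieves, §4.2 (Lemma 4.6)] -/
theorem eventually_not_typeII_shortInterval_top {c θ ν B η : ℝ} (hθ : 0 ≤ θ) (hν : 0 < ν)
    (hc : 1 - c < θ + ν) (hη : 0 ≤ η) (hηc : η < c) (hθη : θ + η < 1) (hB : 1 < B) :
    ∀ᶠ x : ℝ in atTop, ∀ (a : ℕ → ℝ) (A : Finset ℕ) (y : ℝ), (A.card : ℝ) ≤ x ^ (1 - c) →
      (∀ v : ℕ, x / 2 < (v : ℝ) → (v : ℝ) ≤ x → a v ≠ 0 → v ∈ A) →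
      x ^ (1 - η) / 2 ≤ y → y ≤ x / 2 →
      ¬ TypeII (fun n : ℕ => a n -
        (Set.Ioc (x - y) x).indicator (fun _ : ℝ => x / (2 * y)) (n : ℝ)) x θ ν B := by
  have hc0 : 0 < c := by linarith
  have hθ1 : θ < 1 := by linarith
  have hm1 : θ ≤ max θ (1 - c) := le_max_left _ _
  have hm2 : 1 - c ≤ max θ (1 - c) := le_max_right _ _
  have hmη : max θ (1 - c) < 1 - η := max_lt (by linarith) (by linarith)
  set κ : ℝ := (max θ (1 - c) + (1 - η)) / 2 with hκdef
  have hκθ : θ < κ := by rw [hκdef]; linarith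
  have hκc : 1 - c < κ := by rw [hκdef]; linarith
  have hκη : κ < 1 - η := by rw [hκdef]; linarith
  filter_upwards [eventually_not_typeII_of_sparse_rows hc0 hθ hθ1 hν hc hκc hκθ hB,
    eventually_mul_rpow_le_rpow 4 hκη, eventually_ge_atTop (1 : ℝ)]
    with x hx e1 hx1 a A y hA hcov hy1 hy2
  have hx0 : 0 < x := by linarith
  have hy0 : 0 < y := lt_of_lt_of_le (by positivity) hy1
  have hb0 : ∀ n : ℕ, 0 ≤ (Set.Ioc (x - y) x).indicator (fun _ : ℝ => x / (2 * y)) (n : ℝ) :=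
    fun n => Set.indicator_nonneg (fun _ _ => by positivity) _
  refine hx a (fun n : ℕ => (Set.Ioc (x - y) x).indicator (fun _ : ℝ => x / (2 * y)) (n : ℝ))
    A ∅ hA hcov hb0 (by simp only [Finset.card_empty, Nat.cast_zero]; positivity) ?_
  intro p hp _ _ hpκ
  have hpy : 2 * (p : ℝ) ≤ y := by linarith
  exact shortInterval_mass hp.pos hpy hy2

/-- **Short intervals, Type II — the window.**  With `0 ≤ η < c ≤ 1`, `θ + η < 1`: unless
`c ≤ θ` and `θ + ν ≤ 1 − c`, a support of size `x^{1−c}` violates (II) in `[θ, θ + ν]` against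
`(x/2y)·1_{x−y<n≤x}` for every `x^{1−η}/2 ≤ y ≤ x/2` (`x` large): below the co-density by
`eventually_not_typeII_shortInterval_sharp`, above it by the preceding theorem.
[cite: FordMaynard2024PrimeSieves, §4.2 (Lemma 4.6)] -/
theorem eventually_not_typeII_shortInterval_window {c θ ν B η : ℝ} (hθ : 0 ≤ θ) (hν : 0 < ν)
    (hη : 0 ≤ η) (hηc : η < c) (hθη : θ + η < 1) (hc1 : c ≤ 1) (hB : 1 < B)
    (hout : θ < c ∨ 1 - c < θ + ν) :
    ∀ᶠ x : ℝ in atTop, ∀ (a : ℕ → ℝ) (A : Finset ℕ) (y : ℝ), (A.card : ℝ) ≤ x ^ (1 - c) →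
      (∀ v : ℕ, x / 2 < (v : ℝ) → (v : ℝ) ≤ x → a v ≠ 0 → v ∈ A) →
      x ^ (1 - η) / 2 ≤ y → y ≤ x / 2 →
      ¬ TypeII (fun n : ℕ => a n -
        (Set.Ioc (x - y) x).indicator (fun _ : ℝ => x / (2 * y)) (n : ℝ)) x θ ν B := by
  rcases hout with h | h
  · exact eventually_not_typeII_shortInterval_sharp hθ h hηc hθη hc1 hν hB
  · exact eventually_not_typeII_shortInterval_top hθ hν h hη hηc hθη hB

/-- **Density at most `x^{1/2}`: no Type-II information at all.**  If `1/2 ≤ c ≤ 1`, then for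
every `θ ≥ 0`, `ν > 0`, `0 ≤ η < c` with `θ + η < 1`, a support of size `x^{1−c}` violates (II) in
`[θ, θ + ν]` against `(x/2y)·1_{x−y<n≤x}` for every `x^{1−η}/2 ≤ y ≤ x/2` (`x` large).
[cite: FordMaynard2024PrimeSieves, §4.2 (Lemma 4.6)] -/
theorem eventually_not_typeII_shortInterval_half {c θ ν B η : ℝ} (hc2 : 1 / 2 ≤ c)
    (hθ : 0 ≤ θ) (hν : 0 < ν) (hη : 0 ≤ η) (hηc : η < c) (hθη : θ + η < 1) (hc1 : c ≤ 1)
    (hB : 1 < B) :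
    ∀ᶠ x : ℝ in atTop, ∀ (a : ℕ → ℝ) (A : Finset ℕ) (y : ℝ), (A.card : ℝ) ≤ x ^ (1 - c) →
      (∀ v : ℕ, x / 2 < (v : ℝ) → (v : ℝ) ≤ x → a v ≠ 0 → v ∈ A) →
      x ^ (1 - η) / 2 ≤ y → y ≤ x / 2 →
      ¬ TypeII (fun n : ℕ => a n -
        (Set.Ioc (x - y) x).indicator (fun _ : ℝ => x / (2 * y)) (n : ℝ)) x θ ν B :=
  eventually_not_typeII_shortInterval_window hθ hν hη hηc hθη hc1 hB
    ((lt_or_ge θ c).imp id fun h => by linarith)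

/-- **Short intervals with a modulus, Type II above the co-density (no height condition).**
Let `0 < c`, `0 ≤ θ < 1`, `ν > 0`, `θ + ν > 1 − c`, `κ > max(θ, 1 − c)`, `B > 1`.  For all large
`x`, every real `a` with at most `x^{1−c}` non-zero values on `(x/2, x]`, every `q ≥ 1` and every
`y ≤ x/2` with `2 x^κ q ≤ y`:  `a − (xq/2)/(yφ(q))·1_{x−y<n≤x,(n,q)=1}` violates (II) in
`[θ, θ + ν]`. [cite: FordMaynard2024PrimeSieves, §4.2 (Lemma 4.6)] -/
theorem eventually_not_typeII_shortInterval_coprime_top {c θ ν B κ : ℝ} (hc0 : 0 < c)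
    (hθ : 0 ≤ θ) (hθ1 : θ < 1) (hν : 0 < ν) (hc : 1 - c < θ + ν) (hκ : 1 - c < κ)
    (hθκ : θ < κ) (hB : 1 < B) :
    ∀ᶠ x : ℝ in atTop, ∀ (a : ℕ → ℝ) (A : Finset ℕ) (y : ℝ) (q : ℕ), (A.card : ℝ) ≤ x ^ (1 - c) →
      (∀ v : ℕ, x / 2 < (v : ℝ) → (v : ℝ) ≤ x → a v ≠ 0 → v ∈ A) → 0 < q →
      2 * x ^ κ * q ≤ y → y ≤ x / 2 →
      ¬ TypeII (fun n : ℕ => a n - (if x - y < (n : ℝ) ∧ (n : ℝ) ≤ x ∧ Nat.Coprime n q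
        then x * q / (2 * y * (q.totient : ℝ)) else 0)) x θ ν B := by
  have hκ0 : 0 ≤ κ := by linarith
  filter_upwards [eventually_not_typeII_of_sparse_rows_coprime hc0 hθ hθ1 hν hc hκ hθκ hB,
    eventually_ge_atTop (1 : ℝ)] with x hx hx1 a A y q hA hcov hq hqy hyx
  have hx0 : 0 < x := by linarith
  have hq1 : (1 : ℝ) ≤ q := by exact_mod_cast hq
  have hxκ : 1 ≤ x ^ κ := Real.one_le_rpow hx1 hκ0
  have hqκ : (q : ℝ) ≤ x ^ κ * q := le_mul_of_one_le_left (by positivity) hxκ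
  have hy0 : 0 < y := by linarith
  have hφ : (0 : ℝ) < (q.totient : ℝ) := by exact_mod_cast Nat.totient_pos.mpr hq
  have hb0 : ∀ n : ℕ, 0 ≤ (if x - y < (n : ℝ) ∧ (n : ℝ) ≤ x ∧ Nat.Coprime n q
      then x * q / (2 * y * (q.totient : ℝ)) else 0) := by
    intro n
    split_ifs
    · positivity
    · exact le_rfl
  refine hx a (fun n : ℕ => if x - y < (n : ℝ) ∧ (n : ℝ) ≤ x ∧ Nat.Coprime n q
      then x * q / (2 * y * (q.totient : ℝ)) else 0) A q hA hcov hb0 hq ?_ ?_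
  · have hxx : x ≤ x ^ 2 := by nlinarith
    linarith
  · intro p hp hndvd _ hpκ
    have hpq : Nat.Coprime p q := (Nat.Prime.coprime_iff_not_dvd hp).mpr hndvd
    have hp2 : 2 * (p : ℝ) * q ≤ y := by
      have : (p : ℝ) * q ≤ x ^ κ * q := mul_le_mul_of_nonneg_right hpκ (by positivity)
      linarith
    exact shortIntervalQ_mass hp.pos hq hpq hp2 hyx

/-- **Polynomial-growth supports, Type II above the co-density.**  Let `d ≥ 2`, `θ ≥ 0`, `ν > 0`,
`θ + ν > 1/d`, `0 ≤ η < 1 − 1/d`, `θ + η < 1`, `B > 1`.  For all large `x`: if `g k ≥ k^d` and `a`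
vanishes on `(x/2, x]` outside the image of `g`, then for every `x^{1−η}/2 ≤ y ≤ x/2`,
`a − (x/2y)·1_{x−y<n≤x}` violates (II) in `[θ, θ + ν]`.
[cite: FordMaynard2024PrimeSieves, §4.2 (Lemma 4.6)] -/
theorem eventually_not_typeII_polyGrowth_shortInterval_top {d : ℕ} (hd : 2 ≤ d)
    {θ ν B η : ℝ} (hθ : 0 ≤ θ) (hν : 0 < ν) (hdθ : 1 / (d : ℝ) < θ + ν) (hη : 0 ≤ η)
    (hηd : η < 1 - 1 / d) (hθη : θ + η < 1) (hB : 1 < B) :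
    ∀ᶠ x : ℝ in atTop, ∀ (g : ℕ → ℕ), (∀ k, k ^ d ≤ g k) → ∀ (a : ℕ → ℝ) (y : ℝ),
      (∀ v : ℕ, x / 2 < (v : ℝ) → (v : ℝ) ≤ x → a v ≠ 0 → ∃ k, g k = v) →
      x ^ (1 - η) / 2 ≤ y → y ≤ x / 2 →
      ¬ TypeII (fun n : ℕ => a n -
        (Set.Ioc (x - y) x).indicator (fun _ : ℝ => x / (2 * y)) (n : ℝ)) x θ ν B := by
  have hd0 : d ≠ 0 := by omega
  have hdr : (2 : ℝ) ≤ d := by exact_mod_cast hd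
  have hdpos : (0 : ℝ) < 1 / d := by positivity
  have hm1 : 1 - θ - ν ≤ max (1 - θ - ν) η := le_max_left _ _
  have hm2 : η ≤ max (1 - θ - ν) η := le_max_right _ _
  have hmax : max (1 - θ - ν) η < 1 - 1 / d := max_lt (by linarith) hηd
  set c : ℝ := (max (1 - θ - ν) η + (1 - 1 / d)) / 2 with hcdef
  have hc : 1 - c < θ + ν := by rw [hcdef]; linarith
  have hηc : η < c := by rw [hcdef]; linarith
  have hc1d : c < 1 - 1 / d := by rw [hcdef]; linarith
  filter_upwards [eventually_not_typeII_shortInterval_top hθ hν hc hη hηc hθη hB,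
    eventually_mul_rpow_le_rpow 2 (by linarith : 1 / (d : ℝ) < 1 - c),
    eventually_ge_atTop (1 : ℝ)] with x hx e1 hx1 g hg a y ha hy1 hy2
  obtain ⟨A, hA, hcov⟩ := exists_cover_of_polyGrowth hd0 hg (by linarith) ha
  have hx1d : 1 ≤ x ^ (1 / d : ℝ) := Real.one_le_rpow hx1 hdpos.le
  exact hx a A y (by linarith) hcov hy1 hy2

/-- **Polynomial-growth supports carry no Type-II information against Ford–Maynard's
short-interval comparisons.**  Let `d ≥ 2`, `θ ≥ 0`, `ν > 0`, `0 ≤ η < 1 − 1/d`, `θ + η < 1`,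
`B > 1` — NO further condition on the window.  For all large `x`: if `g k ≥ k^d` and `a`
vanishes on `(x/2, x]` outside the image of `g`, then for every `x^{1−η}/2 ≤ y ≤ x/2`,
`a − (x/2y)·1_{x−y<n≤x}` violates (II) in `[θ, θ + ν]` (`θ < 1/2`: below the co-density,
`eventually_not_typeII_polyGrowth_shortInterval_sharp`; `θ ≥ 1/2`: above it).
[cite: FordMaynard2024PrimeSieves, §4.2 (Lemma 4.6)] -/
theorem eventually_not_typeII_polyGrowth_shortInterval_all {d : ℕ} (hd : 2 ≤ d)
    {θ ν B η : ℝ} (hθ : 0 ≤ θ) (hν : 0 < ν) (hη : 0 ≤ η) (hηd : η < 1 - 1 / d)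
    (hθη : θ + η < 1) (hB : 1 < B) :
    ∀ᶠ x : ℝ in atTop, ∀ (g : ℕ → ℕ), (∀ k, k ^ d ≤ g k) → ∀ (a : ℕ → ℝ) (y : ℝ),
      (∀ v : ℕ, x / 2 < (v : ℝ) → (v : ℝ) ≤ x → a v ≠ 0 → ∃ k, g k = v) →
      x ^ (1 - η) / 2 ≤ y → y ≤ x / 2 →
      ¬ TypeII (fun n : ℕ => a n -
        (Set.Ioc (x - y) x).indicator (fun _ : ℝ => x / (2 * y)) (n : ℝ)) x θ ν B := by
  have hdr : (2 : ℝ) ≤ d := by exact_mod_cast hd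
  have hd2 : 1 / (d : ℝ) ≤ 1 / 2 := by
    rw [div_le_div_iff₀ (by positivity) (by norm_num)]; linarith
  rcases lt_or_ge θ (1 / 2) with h | h
  · exact eventually_not_typeII_polyGrowth_shortInterval_sharp hd hθ (by linarith) hηd hθη hν hB
  · exact eventually_not_typeII_polyGrowth_shortInterval_top hd hθ hν (by linarith) hη hηd hθη hB

/-- **`n² + 1` carries no Type-II information against the short-interval comparisons**: for
every `θ ≥ 0`, `ν > 0`, `0 ≤ η < 1/2` with `θ + η < 1`, and every `x^{1−η}/2 ≤ y ≤ x/2`, no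
weighting of the `k² + 1` in `(x/2, x]` makes `a − (x/2y)·1_{x−y<n≤x}` satisfy (II) in
`[θ, θ + ν]` (`x` large). [cite: FordMaynard2024PrimeSieves, §4.2 (Lemma 4.6)] -/
theorem eventually_not_typeII_sq_add_one_shortInterval_all {θ ν B η : ℝ} (hθ : 0 ≤ θ)
    (hν : 0 < ν) (hη : 0 ≤ η) (hη2 : η < 1 / 2) (hθη : θ + η < 1) (hB : 1 < B) :
    ∀ᶠ x : ℝ in atTop, ∀ (a : ℕ → ℝ) (y : ℝ),
      (∀ v : ℕ, x / 2 < (v : ℝ) → (v : ℝ) ≤ x → a v ≠ 0 → ∃ k, k ^ 2 + 1 = v) →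
      x ^ (1 - η) / 2 ≤ y → y ≤ x / 2 →
      ¬ TypeII (fun n : ℕ => a n -
        (Set.Ioc (x - y) x).indicator (fun _ : ℝ => x / (2 * y)) (n : ℝ)) x θ ν B := by
  have h2 : η < 1 - 1 / ((2 : ℕ) : ℝ) := by push_cast; linarith
  filter_upwards [eventually_not_typeII_polyGrowth_shortInterval_all (le_refl 2) hθ hν hη h2 hθη
    hB] with x hx a y ha
  exact hx (fun k => k ^ 2 + 1) (fun k => Nat.le_succ _) a y ha

/-- **Polynomial-growth supports vs. the twisted sequences, Type II above the co-density.**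
Let `d ≥ 2`, `0 ≤ θ < 1`, `θ < κ`, `ν > 0`, `θ + ν > 1/d`, `κ > 1/d`, `B > 1`.  For all large `x`:
if `g k ≥ k^d` and `a` vanishes on `(x/2, x]` outside the image of `g`, then for every `q ≥ 1`
and `y ≤ x/2` with `2x^κ q ≤ y`, `a − (xq/2)/(yφ(q))·1_{x−y<n≤x,(n,q)=1}` violates (II) in
`[θ, θ + ν]`. [cite: FordMaynard2024PrimeSieves, §4.2 (Lemma 4.6)] -/
theorem eventually_not_typeII_polyGrowth_shortInterval_coprime_top {d : ℕ} (hd : 2 ≤ d)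
    {θ ν B κ : ℝ} (hθ : 0 ≤ θ) (hθ1 : θ < 1) (hθκ : θ < κ) (hν : 0 < ν)
    (hdθ : 1 / (d : ℝ) < θ + ν) (hdκ : 1 / (d : ℝ) < κ) (hB : 1 < B) :
    ∀ᶠ x : ℝ in atTop, ∀ (g : ℕ → ℕ), (∀ k, k ^ d ≤ g k) → ∀ (a : ℕ → ℝ) (y : ℝ) (q : ℕ),
      (∀ v : ℕ, x / 2 < (v : ℝ) → (v : ℝ) ≤ x → a v ≠ 0 → ∃ k, g k = v) → 0 < q →
      2 * x ^ κ * q ≤ y → y ≤ x / 2 →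
      ¬ TypeII (fun n : ℕ => a n - (if x - y < (n : ℝ) ∧ (n : ℝ) ≤ x ∧ Nat.Coprime n q
        then x * q / (2 * y * (q.totient : ℝ)) else 0)) x θ ν B := by
  have hd0 : d ≠ 0 := by omega
  have hdr : (2 : ℝ) ≤ d := by exact_mod_cast hd
  have hdpos : (0 : ℝ) < 1 / d := by positivity
  have hd1 : 1 / (d : ℝ) ≤ 1 / 2 := by
    rw [div_le_div_iff₀ (by positivity) (by norm_num)]; linarith
  set m₀ : ℝ := max (max (1 - θ - ν) (1 - κ)) 0 with hm₀def
  have hm1 : 1 - θ - ν ≤ m₀ := (le_max_left _ _).trans (le_max_left _ _)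
  have hm2 : 1 - κ ≤ m₀ := (le_max_right _ _).trans (le_max_left _ _)
  have hm3 : 0 ≤ m₀ := le_max_right _ _
  have hmax : m₀ < 1 - 1 / d := max_lt (max_lt (by linarith) (by linarith)) (by linarith)
  set c : ℝ := (m₀ + (1 - 1 / d)) / 2 with hcdef
  have hc : 1 - c < θ + ν := by rw [hcdef]; linarith
  have hκc : 1 - c < κ := by rw [hcdef]; linarith
  have hc1d : c < 1 - 1 / d := by rw [hcdef]; linarith
  have hc0 : 0 < c := by rw [hcdef]; linarith
  filter_upwards [eventually_not_typeII_shortInterval_coprime_top hc0 hθ hθ1 hν hc hκc hθκ hB,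
    eventually_mul_rpow_le_rpow 2 (by linarith : 1 / (d : ℝ) < 1 - c),
    eventually_ge_atTop (1 : ℝ)] with x hx e1 hx1 g hg a y q ha hq hqy hyx
  obtain ⟨A, hA, hcov⟩ := exists_cover_of_polyGrowth hd0 hg (by linarith) ha
  have hx1d : 1 ≤ x ^ (1 / d : ℝ) := Real.one_le_rpow hx1 hdpos.le
  exact hx a A y q (by linarith) hcov hq hqy hyx

/-- **Polynomial-growth supports vs. the twisted sequences: no Type-II information.**  Let
`d ≥ 2`, `0 ≤ θ < 1`, `θ < κ`, `ν > 0`, `η < 1 − 1/d`, `B > 1`.  For all large `x`: if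
`g k ≥ k^d` and `a` vanishes on `(x/2, x]` outside the image of `g`, then for every `q ≥ 1` and
`y ≤ x/2` with `x^{1−η}/2 ≤ y`, `2x^κ q ≤ y`, `a − (xq/2)/(yφ(q))·1_{x−y<n≤x,(n,q)=1}` violates
(II) in `[θ, θ + ν]` (`θ < 1/2` by `eventually_not_typeII_polyGrowth_shortInterval_coprime_sharp'`,
`θ ≥ 1/2` by the preceding theorem).  For `k² + 1`: `η < 1/2`.
[cite: FordMaynard2024PrimeSieves, §4.2 (Lemma 4.6)] -/
theorem eventually_not_typeII_polyGrowth_shortInterval_coprime_all {d : ℕ} (hd : 2 ≤ d)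
    {θ ν B η κ : ℝ} (hθ : 0 ≤ θ) (hθ1 : θ < 1) (hθκ : θ < κ) (hν : 0 < ν)
    (hηd : η < 1 - 1 / d) (hB : 1 < B) :
    ∀ᶠ x : ℝ in atTop, ∀ (g : ℕ → ℕ), (∀ k, k ^ d ≤ g k) → ∀ (a : ℕ → ℝ) (y : ℝ) (q : ℕ),
      (∀ v : ℕ, x / 2 < (v : ℝ) → (v : ℝ) ≤ x → a v ≠ 0 → ∃ k, g k = v) → 0 < q →
      x ^ (1 - η) / 2 ≤ y → 2 * x ^ κ * q ≤ y → y ≤ x / 2 →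
      ¬ TypeII (fun n : ℕ => a n - (if x - y < (n : ℝ) ∧ (n : ℝ) ≤ x ∧ Nat.Coprime n q
        then x * q / (2 * y * (q.totient : ℝ)) else 0)) x θ ν B := by
  have hdr : (2 : ℝ) ≤ d := by exact_mod_cast hd
  have hd1 : 1 / (d : ℝ) ≤ 1 / 2 := by
    rw [div_le_div_iff₀ (by positivity) (by norm_num)]; linarith
  rcases lt_or_ge θ (1 / 2) with h | h
  · -- below the co-density: shrink `κ` into `(θ, 1 − 1/d)`
    have hu : θ < 1 - 1 / d := by linarith
    set κ' : ℝ := min κ ((θ + (1 - 1 / d)) / 2) with hκ'def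
    have hκ'κ : κ' ≤ κ := min_le_left _ _
    have hθκ' : θ < κ' := lt_min hθκ (by linarith)
    have hκ'd : κ' < 1 - 1 / d := lt_of_le_of_lt (min_le_right _ _) (by linarith)
    filter_upwards [eventually_not_typeII_polyGrowth_shortInterval_coprime_sharp' hd hθ hθκ'
      hκ'd hηd hν hB, eventually_ge_atTop (1 : ℝ)] with x hx hx1 g hg a y q ha hq hy1 hqy hyx
    have hq0 : (0 : ℝ) ≤ q := Nat.cast_nonneg _
    have hxκ : x ^ κ' ≤ x ^ κ := Real.rpow_le_rpow_of_exponent_le hx1 hκ'κ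
    have hqy' : 2 * x ^ κ' * q ≤ y :=
      le_trans (mul_le_mul_of_nonneg_right (by linarith) hq0) hqy
    exact hx g hg a y q ha hq hy1 hqy' hyx
  · filter_upwards [eventually_not_typeII_polyGrowth_shortInterval_coprime_top hd hθ hθ1 hθκ hν
      (by linarith) (by linarith) hB] with x hx g hg a y q ha hq _ hqy hyx
    exact hx g hg a y q ha hq hqy hyx

/-- **`n² + 1` vs. the twisted sequences: no Type-II information** — `0 ≤ θ < 1`, `θ < κ`,
`ν > 0`, `η < 1/2`, `q ≥ 1`, `x^{1−η}/2 ≤ y ≤ x/2`, `2x^κ q ≤ y`.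
[cite: FordMaynard2024PrimeSieves, §4.2 (Lemma 4.6)] -/
theorem eventually_not_typeII_sq_add_one_shortInterval_coprime_all {θ ν B η κ : ℝ}
    (hθ : 0 ≤ θ) (hθ1 : θ < 1) (hθκ : θ < κ) (hν : 0 < ν) (hη2 : η < 1 / 2) (hB : 1 < B) :
    ∀ᶠ x : ℝ in atTop, ∀ (a : ℕ → ℝ) (y : ℝ) (q : ℕ),
      (∀ v : ℕ, x / 2 < (v : ℝ) → (v : ℝ) ≤ x → a v ≠ 0 → ∃ k, k ^ 2 + 1 = v) → 0 < q →
      x ^ (1 - η) / 2 ≤ y → 2 * x ^ κ * q ≤ y → y ≤ x / 2 →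
      ¬ TypeII (fun n : ℕ => a n - (if x - y < (n : ℝ) ∧ (n : ℝ) ≤ x ∧ Nat.Coprime n q
        then x * q / (2 * y * (q.totient : ℝ)) else 0)) x θ ν B := by
  have h2 : η < 1 - 1 / ((2 : ℕ) : ℝ) := by push_cast; linarith
  filter_upwards [eventually_not_typeII_polyGrowth_shortInterval_coprime_all (le_refl 2) hθ hθ1
    hθκ hν h2 hB] with x hx a y q ha
  exact hx (fun k => k ^ 2 + 1) (fun k => Nat.le_succ _) a y q ha

end Summit.Parity.BatemanHorn.Theorems

end
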